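/-
Copyright (c) 2026. All rights reserved.
Released under Apache 2.0 license as described in the file LICENSE.
Authors: abc-iut cell, seat abc-iut-L6-t6 (the last sentence of [IUTchIII] Example 3.6 (iii), part 1:
non-uniqueness before perfection).
-/
import Literature.IUT.LogThetaLattice.GlobalFrobenioidModelsIdentification
import Literature.AlgebraicGeometry.Frobenioids.PerfectionFunctoriality
import HarnessLib

/-!
# [IUTchIII] Example 3.6 (iii), last sentence — part 1: the identification `𝓕⊛_𝔪𝔬𝔡 ⥲ 𝓕⊛_MOD` is NOT
# determined by "inducing the identity on `F^×_mod`": the unit twists of `𝓕⊛_𝔪𝔬𝔡`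

S. Mochizuki, *Inter-universal Teichmüller Theory III*, kurims manuscript (May 2020), Example 3.6 (iii),
p. 108 l. 18–27 [claim key Mochizuki2012, status disputed (D-0012)]: "… one thus obtains a natural isomorphism
of Frobenioids `𝓕⊛_𝔪𝔬𝔡 ⥲ 𝓕⊛_MOD` that induces the identity morphism `F^×_mod → F^×_mod` on the associated rational
function monoids [cf. [FrdI], Corollary 4.10]. One verifies immediately that although the above isomorphism
of Frobenioids is not necessarily determined by the condition that it induce the identity morphism on
`F^×_mod`, the induced isomorphism between the respective perfections [hence also on realifications] of
`𝓕⊛_𝔪𝔬𝔡`, `𝓕⊛_MOD` is completely determined by this condition."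

The identification is the tree's `toMOD : 𝓕⊛_𝔪𝔬𝔡 ⥤ 𝓕⊛_MOD` (`GlobalFrobenioidModelsIdentification.lean`, abc-iut-L6-t6).
THIS FILE proves the first half of the last sentence by exhibiting the indeterminacy. For `u ∈ F^×_mod` with
`β_v(u) = 0` for every `v` (a unit at every place; at the number-field model any root of unity, e.g. `−1` —
companion `GlobalFrobenioidModelsPerfectionRigidity.lean`), the **unit twist**
  `Ψ_u : 𝓕⊛_𝔪𝔬𝔡 ⥤ 𝓕⊛_𝔪𝔬𝔡`, `𝔍 ↦ 𝔍`, `(n, f) ↦ (1, u)⁻¹ ≫ (n, f) ≫ (1, u) = (n, u · f · u^{−n})`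
(conjugation by the constant family of unit automorphisms `(1, u) ∈ 𝒪^×(𝔍)`, `unitTwist`) is the identity on
objects and on every LINEAR morphism (`unitTwist_map_of_deg_eq_one`) — so it induces the identity
`F^×_mod → F^×_mod` —, is compatible with the Frobenioid structure `𝓕⊛_𝔪𝔬𝔡 → F_Φ` ON THE NOSE
(`structureFunctor_map_unitTwist`; hence `isFrobeniusCompatible_unitTwist`, the hypothesis of abc-iut-L1-d9's
functoriality `PreFrobenioid.Perfection.map` of THE perfection, [FrdI] Def. 3.1 (iii) / Thm. 3.4 (iii)), is an
auto-equivalence `≅ 𝟭` (`unitTwistIso`), but is NOT `𝟭` when `u ≠ 1`: `(2, 1) : 𝒪 → 𝒪` goes to `(2, u⁻¹)`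
(`unitTwist_ne_id`). Hence `Ψ_u ⋙ toMOD` is a SECOND isomorphism of Frobenioids `𝓕⊛_𝔪𝔬𝔡 ⥲ 𝓕⊛_MOD` inducing the
identity on `F^×_mod`, compatible with the Frobenioid structures exactly as `toMOD` is
(`structureFunctorMOD_map_toMOD`, `…_twistedToMOD`), equal to `toMOD` on objects and linear morphisms, and
`≠ toMOD` (`twistedToMOD_ne_toMOD`; packaged: `ex36iii_not_determined`). The second half of the sentence — on
THE perfections all these twists induce the same functor — is the proof-only companion
`GlobalFrobenioidModelsPerfectionRigidity.lean`.

READING (disclosed). "Determined" is read ON THE NOSE for functors with the given action on objects: up to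
natural isomorphism there is nothing to determine (`Ψ_u ≅ 𝟭`), and without fixing objects the on-the-nose claim
fails even on perfections (conjugation along `(1, g) : 𝔍 ⥲ g⁻¹·𝔍` also fixes every `f` on linear morphisms).
The realification clause is not treated (the tree's `C^rlf` is a schema over `RealificationData`).
HONEST FRAMING: elementary category theory of the tree's own model of Ex. 3.6; nothing here bears on
[IUTchIII] Cor. 3.12; typed ≠ endorsed.
-/

noncomputable section

namespace Literature.IUT.LogThetaLattice

namespace GlobalFrobenioidModels

open CategoryTheory Opposite Literature.AlgebraicGeometry.Frobenioids

universe u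

variable {F : Type u} [Field F] {V : Type u} {Γ : V → Type u} [∀ v, AddCommGroup (Γ v)]
  {nonneg : ∀ v, AddSubmonoid (Γ v)} {β : ∀ v, Additive Fˣ →+ Γ v}

namespace FrakCat

/-! ### Units at every place and the automorphisms `(1, u)` -/

section UnitTwist

variable (u : Fˣ) (hu : ∀ v, β v (Additive.ofMul u) = 0)
include hu

/-- `(n, u^k · f)` is a morphism `𝔍₁ → 𝔍₂` whenever `(n, f)` is, for `u` a unit at every place (integrality
only sees `β_v(f)`). ([IUTchIII] Ex 3.6 (iii) p.108) [claim: Mochizuki2012, status: disputed] -/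
theorem isHom_unit_zpow_mul {X Y : FrakObj V Γ} {n : ℕ+} {f : Fˣ}
    (h : FrakObj.IsHom (nonneg := nonneg) (β := β) X Y n f) (k : ℤ) :
    FrakObj.IsHom (nonneg := nonneg) (β := β) X Y n (u ^ k * f) := by
  intro v
  have e : β v (Additive.ofMul (u ^ k * f)) = β v (Additive.ofMul f) := by
    rw [ofMul_mul, map_add, ofMul_zpow, map_zsmul, hu, smul_zero, zero_add]
  have := h v
  rw [e]
  exact this

/-- `(1, u) : 𝔍 → 𝔍` is a morphism of `𝓕⊛_𝔪𝔬𝔡`. ([IUTchIII] Ex 3.6 (iii) p.108) [claim: Mochizuki2012, status: disputed] -/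
theorem isHom_one_unit (X : FrakObj V Γ) :
    FrakObj.IsHom (nonneg := nonneg) (β := β) X X 1 u := by
  have h := isHom_unit_zpow_mul (nonneg := nonneg) u hu (FrakObj.isHom_one_one (β := β) X) 1
  rwa [zpow_one, mul_one] at h

/-- `(1, u⁻¹) : 𝔍 → 𝔍` is a morphism of `𝓕⊛_𝔪𝔬𝔡`. ([IUTchIII] Ex 3.6 (iii) p.108) [claim: Mochizuki2012, status: disputed] -/
theorem isHom_one_unit_inv (X : FrakObj V Γ) :
    FrakObj.IsHom (nonneg := nonneg) (β := β) X X 1 u⁻¹ := by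
  have h := isHom_unit_zpow_mul (nonneg := nonneg) u hu (FrakObj.isHom_one_one (β := β) X) (-1)
  rwa [zpow_neg_one, mul_one] at h

/-- **The unit automorphism `(1, u) ∈ 𝒪^×(𝔍)`** of an object of `𝓕⊛_𝔪𝔬𝔡` (inverse `(1, u⁻¹)`). ([IUTchIII] Ex 3.6 (iii) p.108) [claim: Mochizuki2012, status: disputed] -/
def unitIso (X : FrakCat F V Γ nonneg β) : X ≅ X where
  hom := homMk 1 u (isHom_one_unit u hu X.obj)
  inv := homMk 1 u⁻¹ (isHom_one_unit_inv u hu X.obj)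
  hom_inv_id := hom_ext rfl (by
    rw [fn_comp, fn_homMk, fn_homMk, deg_homMk, PNat.one_coe, pow_one, inv_mul_cancel, fn_id])
  inv_hom_id := hom_ext rfl (by
    rw [fn_comp, fn_homMk, fn_homMk, deg_homMk, PNat.one_coe, pow_one, mul_inv_cancel, fn_id])

/-- `deg (1, u) = 1`. ([IUTchIII] Ex 3.6 (iii) p.108) [claim: Mochizuki2012, status: disputed] -/
@[simp] theorem deg_unitIso_hom (X : FrakCat F V Γ nonneg β) : deg (unitIso u hu X).hom = 1 := rfl

/-- `fn (1, u) = u`. ([IUTchIII] Ex 3.6 (iii) p.108) [claim: Mochizuki2012, status: disputed] -/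
@[simp] theorem fn_unitIso_hom (X : FrakCat F V Γ nonneg β) : fn (unitIso u hu X).hom = u := rfl

/-- `deg (1, u⁻¹) = 1`. ([IUTchIII] Ex 3.6 (iii) p.108) [claim: Mochizuki2012, status: disputed] -/
@[simp] theorem deg_unitIso_inv (X : FrakCat F V Γ nonneg β) : deg (unitIso u hu X).inv = 1 := rfl

/-- `fn (1, u⁻¹) = u⁻¹`. ([IUTchIII] Ex 3.6 (iii) p.108) [claim: Mochizuki2012, status: disputed] -/
@[simp] theorem fn_unitIso_inv (X : FrakCat F V Γ nonneg β) : fn (unitIso u hu X).inv = u⁻¹ := rfl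

/-! ### The unit twist `Ψ_u` -/

/-- **The unit twist `Ψ_u : 𝓕⊛_𝔪𝔬𝔡 ⥤ 𝓕⊛_𝔪𝔬𝔡`**: conjugation by the constant family of unit automorphisms
`(1, u)` — the identity on objects, `φ ↦ (1, u)⁻¹ ≫ φ ≫ (1, u)`, i.e. `(n, f) ↦ (n, u · f · u^{−n})`.
([IUTchIII] Ex 3.6 (iii) p.108) [claim: Mochizuki2012, status: disputed] -/
def unitTwist : FrakCat F V Γ nonneg β ⥤ FrakCat F V Γ nonneg β where
  obj X := X
  map {X Y} φ := (unitIso u hu X).inv ≫ φ ≫ (unitIso u hu Y).hom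
  map_id X := by rw [Category.id_comp, Iso.inv_hom_id]
  map_comp {X Y Z} φ ψ := by simp only [Category.assoc, Iso.hom_inv_id_assoc]

/-- `Ψ_u` is the identity on objects. ([IUTchIII] Ex 3.6 (iii) p.108) [claim: Mochizuki2012, status: disputed] -/
@[simp] theorem unitTwist_obj (X : FrakCat F V Γ nonneg β) : (unitTwist u hu).obj X = X := rfl

/-- `Ψ_u` on morphisms is conjugation by `(1, u)`. ([IUTchIII] Ex 3.6 (iii) p.108) [claim: Mochizuki2012, status: disputed] -/
theorem unitTwist_map {X Y : FrakCat F V Γ nonneg β} (φ : X ⟶ Y) :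
    (unitTwist u hu).map φ = (unitIso u hu X).inv ≫ φ ≫ (unitIso u hu Y).hom := rfl

/-- `Ψ_u` preserves Frobenius degrees. ([IUTchIII] Ex 3.6 (iii) p.108) [claim: Mochizuki2012, status: disputed] -/
@[simp] theorem deg_unitTwist_map {X Y : FrakCat F V Γ nonneg β} (φ : X ⟶ Y) :
    deg ((unitTwist u hu).map φ) = deg φ := by
  rw [unitTwist_map, deg_comp, deg_comp, deg_unitIso_hom, deg_unitIso_inv, one_mul, mul_one]

/-- The element of `Ψ_u(n, f)` is `u · f · u^{−n}`. ([IUTchIII] Ex 3.6 (iii) p.108) [claim: Mochizuki2012, status: disputed] -/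
theorem fn_unitTwist_map {X Y : FrakCat F V Γ nonneg β} (φ : X ⟶ Y) :
    fn ((unitTwist u hu).map φ) = u * fn φ * u⁻¹ ^ (deg φ : ℕ) := by
  rw [unitTwist_map, fn_comp, fn_comp, fn_unitIso_hom, fn_unitIso_inv, deg_comp, deg_unitIso_hom,
    PNat.mul_coe, PNat.one_coe, one_mul, pow_one, mul_assoc]

/-- `β_v` does not see the twist: `β_v(u · f · u^{−n}) = β_v(f)`. ([IUTchIII] Ex 3.6 (iii) p.108) [claim: Mochizuki2012, status: disputed] -/
theorem beta_fn_unitTwist_map {X Y : FrakCat F V Γ nonneg β} (φ : X ⟶ Y) (v : V) :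
    β v (Additive.ofMul (fn ((unitTwist u hu).map φ))) = β v (Additive.ofMul (fn φ)) := by
  rw [fn_unitTwist_map, ofMul_mul, ofMul_mul, ofMul_pow, ofMul_inv, map_add, map_add, map_nsmul, map_neg,
    hu, neg_zero, smul_zero, add_zero, zero_add]

/-- **`Ψ_u` induces the identity on `F^×_mod`**: it FIXES every linear morphism (`n = 1`: `u · f · u⁻¹ = f`),
in particular every elementary morphism `f : 𝔍₁ → 𝔍₂` and every element of the rational function monoid.
([IUTchIII] Ex 3.6 (iii) p.108) [claim: Mochizuki2012, status: disputed] -/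
theorem unitTwist_map_of_deg_eq_one {X Y : FrakCat F V Γ nonneg β} (φ : X ⟶ Y) (h : deg φ = 1) :
    (unitTwist u hu).map φ = φ :=
  hom_ext (deg_unitTwist_map u hu φ) (by rw [fn_unitTwist_map, h, PNat.one_coe, pow_one, mul_inv_cancel_comm])

/-- **`Ψ_u ≅ 𝟭`**: the unit twist is naturally isomorphic to the identity functor (components `(1, u)⁻¹`).
([IUTchIII] Ex 3.6 (iii) p.108) [claim: Mochizuki2012, status: disputed] -/
def unitTwistIso : unitTwist u hu ≅ 𝟭 (FrakCat F V Γ nonneg β) :=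
  NatIso.ofComponents (fun X => (unitIso u hu X).symm) fun {X Y} φ => by
    change ((unitIso u hu X).inv ≫ φ ≫ (unitIso u hu Y).hom) ≫ (unitIso u hu Y).inv = (unitIso u hu X).inv ≫ φ
    rw [Category.assoc, Category.assoc, Iso.hom_inv_id, Category.comp_id]

/-- `Ψ_u` is an auto-equivalence of `𝓕⊛_𝔪𝔬𝔡`. ([IUTchIII] Ex 3.6 (iii) p.108) [claim: Mochizuki2012, status: disputed] -/
instance unitTwist_isEquivalence : (unitTwist (nonneg := nonneg) u hu).IsEquivalence :=
  Functor.isEquivalence_of_iso (unitTwistIso u hu).symm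

/-! ### Compatibility with the Frobenioid structure -/

section Structure

variable (H : ModelHyps nonneg β)

/-- The zero divisor of `Ψ_u(φ)` is the zero divisor of `φ` (`β_v(u) = 0`). ([IUTchIII] Ex 3.6 (iii) p.108) [claim: Mochizuki2012, status: disputed] -/
theorem homDiv_unitTwist_map {X Y : FrakCat F V Γ nonneg β} (φ : X ⟶ Y) :
    homDiv H ((unitTwist u hu).map φ) = homDiv H φ := by
  apply Multiplicative.toAdd.injective
  apply Subtype.ext
  rw [coe_homDiv, coe_homDiv, deg_unitTwist_map]
  congr 1
  congr 1
  apply FrakObj.ext_cls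
  funext v
  rw [cls_betaDiv, cls_betaDiv, beta_fn_unitTwist_map]

/-- **`Ψ_u` is compatible with the Frobenioid structure ON THE NOSE**: `𝓕⊛_𝔪𝔬𝔡 → F_Φ` takes the same value on
`Ψ_u(φ)` and on `φ` (same base arrow, same zero divisor, same Frobenius degree).
([IUTchIII] Ex 3.6 (iii) p.108) [claim: Mochizuki2012, status: disputed] -/
theorem structureFunctor_map_unitTwist {X Y : FrakCat F V Γ nonneg β} (φ : X ⟶ Y) :
    (structureFunctor H).map ((unitTwist u hu).map φ) = (structureFunctor H).map φ :=
  ElemFrobenioid.Hom.ext rfl (homDiv_unitTwist_map u hu H φ) (deg_unitTwist_map u hu φ)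

/-- `Ψ_u` preserves arrows of Frobenius type and their Frobenius degrees (abc-iut-L1-d9's hypotheses for the
functoriality of the perfection, [FrdI] Thm. 3.4 (iii)). ([IUTchIII] Ex 3.6 (iii) p.108) [claim: Mochizuki2012, status: disputed] -/
theorem isFrobeniusCompatible_unitTwist :
    PreFrobenioid.IsFrobeniusCompatible (structureFunctor H) (structureFunctor H) (unitTwist u hu) where
  isFrobeniusType_map {X Y} φ hφ := by
    rw [PreFrobenioid.isFrobeniusType_iff_of_isOfIsotropicType _ (isOfIsotropicType H)] at hφ ⊢
    unfold PreFrobenioid.IsIsometry PreFrobenioid.IsBaseIso PreFrobenioid.Div PreFrobenioid.Base at hφ ⊢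
    rw [structureFunctor_map_unitTwist]
    exact hφ
  degFr_map {X Y} φ _ := by
    unfold PreFrobenioid.degFr
    rw [structureFunctor_map_unitTwist]

omit hu in
/-- The identity functor is (trivially) Frobenius-compatible. ([IUTchIII] Ex 3.6 (iii) p.108) [claim: Mochizuki2012, status: disputed] -/
theorem isFrobeniusCompatible_id :
    PreFrobenioid.IsFrobeniusCompatible (structureFunctor H) (structureFunctor H) (𝟭 (FrakCat F V Γ nonneg β)) :=
  ⟨fun _ _ _ h => h, fun _ _ _ _ => rfl⟩

end Structure

/-! ### `Ψ_u ≠ 𝟭` -/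

omit hu in
/-- `(2, 1)` is an endomorphism of the trivial family `𝒪`. ([IUTchIII] Ex 3.6 (iii) p.108) [claim: Mochizuki2012, status: disputed] -/
theorem isHom_two_one : FrakObj.IsHom (nonneg := nonneg) (β := β) (0 : FrakObj V Γ) 0 2 1 := by
  intro v
  rw [ofMul_one, map_zero, zero_add]
  show ((2 : ℕ) : ℤ) • (0 : FrakObj V Γ).cls v - (0 : FrakObj V Γ).cls v ∈ nonneg v
  rw [FrakObj.cls_zero, smul_zero, sub_zero]
  exact (nonneg v).zero_mem

omit hu in
/-- `(2, 1) : 𝒪 → 𝒪` as a morphism of `𝓕⊛_𝔪𝔬𝔡`. ([IUTchIII] Ex 3.6 (iii) p.108) [claim: Mochizuki2012, status: disputed] -/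
def frobTwo : (FrakCat.of 0 : FrakCat F V Γ nonneg β) ⟶ FrakCat.of 0 := homMk 2 1 isHom_two_one

/-- `Ψ_u(2, 1) = (2, u⁻¹)`. ([IUTchIII] Ex 3.6 (iii) p.108) [claim: Mochizuki2012, status: disputed] -/
theorem fn_unitTwist_map_frobTwo : fn ((unitTwist u hu).map (frobTwo (nonneg := nonneg) (β := β))) = u⁻¹ := by
  rw [fn_unitTwist_map]
  show u * 1 * u⁻¹ ^ ((2 : ℕ+) : ℕ) = u⁻¹
  rw [mul_one, show ((2 : ℕ+) : ℕ) = 2 from rfl, pow_two, ← mul_assoc, mul_inv_cancel, one_mul]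

/-- For `u ≠ 1` the unit twist MOVES `(2, 1) : 𝒪 → 𝒪`. ([IUTchIII] Ex 3.6 (iii) p.108) [claim: Mochizuki2012, status: disputed] -/
theorem unitTwist_map_frobTwo_ne (hu1 : u ≠ 1) :
    (unitTwist u hu).map (frobTwo (nonneg := nonneg) (β := β)) ≠ frobTwo := by
  intro h
  have h' := congrArg fn h
  rw [fn_unitTwist_map_frobTwo] at h'
  exact hu1 (inv_eq_one.mp h')

/-- **`Ψ_u ≠ 𝟭` for `u ≠ 1`**: the isomorphism of Frobenioids `Ψ_u` induces the identity on `F^×_mod` and on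
the Frobenioid structure, yet is not the identity. ([IUTchIII] Ex 3.6 (iii) p.108) [claim: Mochizuki2012, status: disputed] -/
theorem unitTwist_ne_id (hu1 : u ≠ 1) : unitTwist u hu ≠ 𝟭 (FrakCat F V Γ nonneg β) := by
  intro h
  apply unitTwist_map_frobTwo_ne u hu hu1
  have := Functor.congr_hom h (frobTwo (nonneg := nonneg) (β := β))
  simpa using this

end UnitTwist

end FrakCat

/-! ### `toMOD` and the Frobenioid structures, on the nose -/

section ToMOD

open FrakCat

variable (H : ModelHyps nonneg β)

/-- `toMOD` is compatible with the Frobenioid structures ON THE NOSE: `𝓕⊛_MOD → F_Φ` (transported along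
`toFrak`) takes on `toMOD(φ)` the value of `𝓕⊛_𝔪𝔬𝔡 → F_Φ` on `φ` (the zero divisor `β(f) + n·𝔍₁ − 𝔍₂` does not
depend on the chosen trivialising points). ([IUTchIII] Ex 3.6 (iii) p.108) [claim: Mochizuki2012, status: disputed] -/
theorem structureFunctorMOD_map_toMOD {X Y : FrakCat F V Γ nonneg β} (φ : X ⟶ Y) :
    (structureFunctorMOD H).map (toMOD.map φ) = (structureFunctor H).map φ := by
  refine ElemFrobenioid.Hom.ext rfl ?_ rfl
  show homDiv H (toFrak.map (toMOD.map φ)) = homDiv H φ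
  apply Multiplicative.toAdd.injective
  apply Subtype.ext
  rw [coe_homDiv, coe_homDiv]
  apply FrakObj.ext_cls
  funext v
  rw [FrakObj.cls_sub, FrakObj.cls_sub, FrakObj.cls_add, FrakObj.cls_add, FrakObj.cls_zsmul,
    FrakObj.cls_zsmul, cls_betaDiv, cls_betaDiv, deg_toFrak_map, deg_toMOD_map, fn_toFrak_map]
  change β v (Additive.ofMul (Additive.toMul
      ((deg φ : ℕ) • (MODCat.pt X.toMODObj : Additive Fˣ) + Additive.ofMul (fn φ) -
        (MODCat.pt Y.toMODObj : Additive Fˣ)))) +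
      ((deg φ : ℕ) : ℤ) • X.toMODObj.frak.cls v - Y.toMODObj.frak.cls v =
    β v (Additive.ofMul (fn φ)) + ((deg φ : ℕ) : ℤ) • X.obj.cls v - Y.obj.cls v
  rw [ofMul_toMul, map_sub, map_add, map_nsmul, cls_frak_toMODObj, cls_frak_toMODObj, ← natCast_zsmul,
    smul_sub]
  abel

/-- `toMOD` is Frobenius-compatible (for the perfection functoriality of [FrdI] Thm. 3.4 (iii)).
([IUTchIII] Ex 3.6 (iii) p.108) [claim: Mochizuki2012, status: disputed] -/
theorem isFrobeniusCompatible_toMOD :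
    PreFrobenioid.IsFrobeniusCompatible (structureFunctor H) (structureFunctorMOD H)
      (toMOD : FrakCat F V Γ nonneg β ⥤ MODCat F V Γ nonneg β) where
  isFrobeniusType_map {X Y} φ hφ := by
    rw [PreFrobenioid.isFrobeniusType_iff_of_isOfIsotropicType _ (isOfIsotropicType H)] at hφ
    rw [PreFrobenioid.isFrobeniusType_iff_of_isOfIsotropicType _ (isOfIsotropicType_MOD H)]
    unfold PreFrobenioid.IsIsometry PreFrobenioid.IsBaseIso PreFrobenioid.Div PreFrobenioid.Base at hφ ⊢
    rw [structureFunctorMOD_map_toMOD]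
    exact hφ
  degFr_map {X Y} φ _ := by
    unfold PreFrobenioid.degFr
    rw [structureFunctorMOD_map_toMOD]

end ToMOD

/-! ### The twisted identification `Ψ_u ⋙ toMOD : 𝓕⊛_𝔪𝔬𝔡 ⥤ 𝓕⊛_MOD` -/

section Twisted

open FrakCat

variable (u : Fˣ) (hu : ∀ v, β v (Additive.ofMul u) = 0)
include hu

/-- The twisted identification agrees with `toMOD` on objects. ([IUTchIII] Ex 3.6 (iii) p.108) [claim: Mochizuki2012, status: disputed] -/
@[simp] theorem twistedToMOD_obj (X : FrakCat F V Γ nonneg β) :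
    (unitTwist u hu ⋙ toMOD).obj X = toMOD.obj X := rfl

/-- The twisted identification on morphisms: `(n, f) ↦ (x ↦ n·x + u·f·u^{−n})`. ([IUTchIII] Ex 3.6 (iii) p.108) [claim: Mochizuki2012, status: disputed] -/
theorem app_twistedToMOD_map {X Y : FrakCat F V Γ nonneg β} (φ : X ⟶ Y) (x : Additive Fˣ) :
    MODCat.app ((unitTwist u hu ⋙ toMOD).map φ) x =
      (deg φ : ℕ) • x + Additive.ofMul (u * fn φ * u⁻¹ ^ (deg φ : ℕ)) := by
  rw [Functor.comp_map, app_toMOD_map, deg_unitTwist_map, fn_unitTwist_map]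

/-- **The twisted identification induces the identity on `F^×_mod`**: on LINEAR morphisms it coincides with
`toMOD` ("the element `f` is sent to itself"). ([IUTchIII] Ex 3.6 (iii) p.108) [claim: Mochizuki2012, status: disputed] -/
theorem twistedToMOD_map_of_deg_eq_one {X Y : FrakCat F V Γ nonneg β} (φ : X ⟶ Y) (h : deg φ = 1) :
    (unitTwist u hu ⋙ toMOD).map φ = toMOD.map φ := by
  rw [Functor.comp_map, unitTwist_map_of_deg_eq_one u hu φ h]
  rfl

/-- The twisted identification is an equivalence of categories. ([IUTchIII] Ex 3.6 (iii) p.108) [claim: Mochizuki2012, status: disputed] -/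
instance twistedToMOD_isEquivalence :
    (unitTwist u hu ⋙ toMOD : FrakCat F V Γ nonneg β ⥤ MODCat F V Γ nonneg β).IsEquivalence :=
  inferInstance

variable (H : ModelHyps nonneg β)

/-- The twisted identification is compatible with the Frobenioid structures exactly as `toMOD` is.
([IUTchIII] Ex 3.6 (iii) p.108) [claim: Mochizuki2012, status: disputed] -/
theorem structureFunctorMOD_map_twistedToMOD {X Y : FrakCat F V Γ nonneg β} (φ : X ⟶ Y) :
    (structureFunctorMOD H).map ((unitTwist u hu ⋙ toMOD).map φ) = (structureFunctor H).map φ :=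
  (structureFunctorMOD_map_toMOD H ((unitTwist u hu).map φ)).trans (structureFunctor_map_unitTwist u hu H φ)

/-- The twisted identification is Frobenius-compatible. ([IUTchIII] Ex 3.6 (iii) p.108) [claim: Mochizuki2012, status: disputed] -/
theorem isFrobeniusCompatible_twistedToMOD :
    PreFrobenioid.IsFrobeniusCompatible (structureFunctor H) (structureFunctorMOD H)
      (unitTwist u hu ⋙ toMOD : FrakCat F V Γ nonneg β ⥤ MODCat F V Γ nonneg β) where
  isFrobeniusType_map {X Y} φ hφ := by
    rw [PreFrobenioid.isFrobeniusType_iff_of_isOfIsotropicType _ (isOfIsotropicType H)] at hφ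
    rw [PreFrobenioid.isFrobeniusType_iff_of_isOfIsotropicType _ (isOfIsotropicType_MOD H)]
    unfold PreFrobenioid.IsIsometry PreFrobenioid.IsBaseIso PreFrobenioid.Div PreFrobenioid.Base at hφ ⊢
    rw [structureFunctorMOD_map_twistedToMOD]
    exact hφ
  degFr_map {X Y} φ _ := by
    unfold PreFrobenioid.degFr
    rw [structureFunctorMOD_map_twistedToMOD]

/-- For `u ≠ 1` the twisted identification MOVES `toMOD(2, 1)`: `x ↦ 2x` versus `x ↦ 2x + u⁻¹`.
([IUTchIII] Ex 3.6 (iii) p.108) [claim: Mochizuki2012, status: disputed] -/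
theorem twistedToMOD_map_frobTwo_ne (hu1 : u ≠ 1) :
    (unitTwist u hu ⋙ toMOD).map (frobTwo (nonneg := nonneg) (β := β)) ≠ toMOD.map frobTwo := by
  intro h
  have h' := congrArg (fun ψ => MODCat.app ψ (0 : Additive Fˣ)) h
  simp only [Functor.comp_map, app_toMOD_map, smul_zero, zero_add, fn_unitTwist_map_frobTwo] at h'
  have h'' : u⁻¹ = 1 := (Additive.ofMul.injective h').trans rfl
  exact hu1 (inv_eq_one.mp h'')

/-- **`Ψ_u ⋙ toMOD ≠ toMOD` for `u ≠ 1`.** ([IUTchIII] Ex 3.6 (iii) p.108) [claim: Mochizuki2012, status: disputed] -/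
theorem twistedToMOD_ne_toMOD (hu1 : u ≠ 1) :
    (unitTwist u hu ⋙ toMOD : FrakCat F V Γ nonneg β ⥤ MODCat F V Γ nonneg β) ≠ toMOD := by
  intro h
  apply twistedToMOD_map_frobTwo_ne u hu hu1
  have := Functor.congr_hom h (frobTwo (nonneg := nonneg) (β := β))
  simpa using this

/-- **[IUTchIII] Ex. 3.6 (iii): the isomorphism of Frobenioids `𝓕⊛_𝔪𝔬𝔡 ⥲ 𝓕⊛_MOD` is NOT determined by the
condition that it induce the identity on `F^×_mod`.** If some `u ≠ 1` in `F^×_mod` is a unit at every place,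
there is an equivalence `Ψ : 𝓕⊛_𝔪𝔬𝔡 ⥤ 𝓕⊛_MOD`, different from `toMOD`, which agrees with `toMOD` on objects and on
all linear morphisms (so induces the identity `F^×_mod → F^×_mod`) and is compatible with the Frobenioid
structures exactly as `toMOD` is — namely `Ψ = Ψ_u ⋙ toMOD`. ([IUTchIII] Ex 3.6 (iii) p.108) [claim: Mochizuki2012, status: disputed] -/
theorem ex36iii_not_determined (H : ModelHyps nonneg β) (hu1 : u ≠ 1) :
    ∃ Ψ : FrakCat F V Γ nonneg β ⥤ MODCat F V Γ nonneg β,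
      Ψ ≠ toMOD ∧ Ψ.IsEquivalence ∧
        (∀ ⦃X Y : FrakCat F V Γ nonneg β⦄ (φ : X ⟶ Y),
          (structureFunctorMOD H).map (Ψ.map φ) = (structureFunctor H).map φ) ∧
        PreFrobenioid.IsFrobeniusCompatible (structureFunctor H) (structureFunctorMOD H) Ψ ∧
        ∃ hobj : ∀ X, Ψ.obj X = toMOD.obj X, ∀ ⦃X Y : FrakCat F V Γ nonneg β⦄ (φ : X ⟶ Y), deg φ = 1 →
          Ψ.map φ = eqToHom (hobj X) ≫ toMOD.map φ ≫ eqToHom (hobj Y).symm :=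
  ⟨unitTwist u hu ⋙ toMOD, twistedToMOD_ne_toMOD u hu hu1, inferInstance,
    fun _ _ φ => structureFunctorMOD_map_twistedToMOD u hu H φ, isFrobeniusCompatible_twistedToMOD u hu H,
    fun _ => rfl, fun X Y φ h => by
      change (unitTwist u hu ⋙ toMOD).map φ = 𝟙 (toMOD.obj X) ≫ toMOD.map φ ≫ 𝟙 (toMOD.obj Y)
      rw [Category.id_comp, Category.comp_id]
      exact twistedToMOD_map_of_deg_eq_one u hu φ h⟩

end Twisted


end GlobalFrobenioidModels

end Literature.IUT.LogThetaLattice
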